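import Literature.NumberTheory.EllipticCurves.AtkinLehnerSymbolSymmetryProofs
import Literature.NumberTheory.EllipticCurves.AtkinLehnerInvolutionsNewformProofs
import HarnessLib

/-!
# The Atkin–Lehner eigenvalue at the prime-to-`p` part of the level: `w_M f = (∏_{q ∣ M} λ(Q_q)) f`
# and `ε(f) = λ(Q_p) · ∏_{q ∣ M} λ(Q_q)` for `N = pM`, `p ∤ M` (Knapp 1993, Lemma 9.24, Thm. 9.27(c))

Topic `NumberTheory/EllipticCurves` (Atkin–Lehner involutions, `AtkinLehnerInvolutions` /
`AtkinLehnerProductProofs`). Theorems only. For `f ∈ S₂(Γ₀(N))` a simultaneous eigenvector of the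
`w_{Q_q}` (`q ∣ N`) — e.g. a newform — and `N = pM` with `p ∤ M`: the product `∏_{q ∣ M} w(Q_q)` of the
canonical Atkin–Lehner matrices is a version of `w(M)` (`exists_slash_eq_prod_smul`; Knapp 1993,
proof of Lemma 9.24: "`w(Q)w(Q')` is a version of `w(QQ')`"), any version slashes like the canonical
one (`slash_eq_slash_atkinLehnerW_of_entries`), so `w_M f = (∏_{q ∣ M} λ_q) f`; and
`ε(f) = ∏_{q ∣ N} λ(Q_q) = λ(Q_p) ∏_{q ∣ M} λ(Q_q)` (Thm. 9.27(c), tree theorem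
`IsNewform0.frickeEigenvalue_eq_prod_atkinLehnerEigenvalueAt_holds`). These identify the sign of the
functional equation of the `p`-adic `L`-function at a prime `p ‖ N` of multiplicative reduction
(`PAdicLFunctionMultiplicativeFunctionalEquationProofs`): `σ = −ε_M`, `ε_N = λ(Q_p) ε_M = −a_p ε_M`.

* `atkinLehnerInvolution_eq_prod_smul_of_level_eq_mul` (simultaneous eigenvector, weight `2`),
  `IsNewform0.atkinLehnerInvolution_eq_prod_smul_of_level_eq_mul` (newform),
  `IsNewform0.frickeEigenvalue_eq_mul_prod_of_level_eq_mul` (any weight).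

## References

* A. W. Knapp, *Elliptic curves*, Math. Notes 40, Princeton UP 1993 (held:
  `book:knapp1993-elliptic-curves-volume-40`): Lemma 9.24 (PDF pp. 215–216), Thm. 9.27 (PDF
  pp. 217–218).
* A. O. L. Atkin, J. Lehner, *Hecke operators on `Γ₀(m)`*, Math. Ann. 185 (1970), Lemmas 8–10, Thm. 3.
-/

noncomputable section

open scoped MatrixGroups ModularForm

open CongruenceSubgroup Matrix.SpecialLinearGroup UpperHalfPlane Complex

namespace Literature.NumberTheory.EllipticCurves.ModularForms

section Complement

variable (N : ℕ) [NeZero N]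

/-- **`w_M f = (∏_{q ∣ M} λ(Q_q)) f` at the prime-to-`p` part `M` of the level `N = pM`, `p ∤ M`**
(weight `2`), for a simultaneous eigenvector `w_{Q_q} f = λ_q f` (`q ∣ N`): the product
`∏_{q ∣ M} w(Q_q)` is a version of `w(M)` (`exists_slash_eq_prod_smul`; Knapp 1993, proof of Lemma
9.24: "`w(Q)w(Q')` is a version of `w(QQ')`"), any version slashes like the canonical one
(`slash_eq_slash_atkinLehnerW_of_entries`), and `w_M f = f ∣[2] w(M)` (one-term formula). For a
newform this is Atkin–Lehner's `λ_M = ∏_{q ∥ M} λ_q`. [cite: Knapp1993, Lemma 9.24 and Thm. 9.27(c)] -/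
theorem atkinLehnerInvolution_eq_prod_smul_of_level_eq_mul {p M : ℕ} [NeZero M] (hp : p.Prime)
    (hNM : N = p * M) (hpM : ¬ p ∣ M) {f : CuspForm (Gamma0 N) 2} {lam : ℕ → ℂ}
    (hlam : ∀ q ∈ N.primeFactors, atkinLehnerInvolutionAt N 2 q f = lam q • f) :
    atkinLehnerInvolution N 2 M f = (∏ q ∈ M.primeFactors, lam q) • f := by
  have hM0 : M ≠ 0 := NeZero.ne M
  -- `M.primeFactors ⊆ N.primeFactors` and `∏_{q ∣ M} q^{v_q(N)} = M`
  have hsub : M.primeFactors ⊆ N.primeFactors := by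
    rw [hNM]; exact Nat.primeFactors_mono ⟨p, mul_comm _ _⟩ (mul_ne_zero hp.ne_zero hM0)
  have hfac : ∀ q ∈ M.primeFactors, N.factorization q = M.factorization q := by
    intro q hq
    have hqp : q ≠ p := by
      rintro rfl; exact hpM (Nat.dvd_of_mem_primeFactors hq)
    rw [hNM, Nat.factorization_mul hp.ne_zero hM0, Finsupp.add_apply, hp.factorization,
      Finsupp.single_apply, if_neg (Ne.symm hqp), zero_add]
  have hprod : ∏ q ∈ M.primeFactors, q ^ N.factorization q = M := by
    rw [Finset.prod_congr rfl fun q hq ↦ by rw [hfac q hq]]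
    exact Nat.prod_factorization_pow_eq_self hM0
  -- the product of the canonical matrices is a version of `w(M)`
  obtain ⟨m, a, b, c, d, hm, hdet, hslash⟩ := exists_slash_eq_prod_smul N 2 hlam M.primeFactors hsub
  rw [hprod] at hm hdet
  have hMN : M ∣ N := ⟨p, by rw [hNM, mul_comm]⟩
  have hc : Nat.Coprime M (N / M) := by
    rw [hNM, Nat.mul_div_cancel _ (NeZero.pos M)]
    exact (Nat.Coprime.symm ((hp.coprime_iff_not_dvd).mpr hpM))
  have h1 : ∀ X : ℕ, ((((X : ℝ) ^ (1 - ((2 : ℤ) : ℝ) / 2) : ℝ) : ℂ)) = 1 := fun X ↦ by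
    rw [show (1 - ((2 : ℤ) : ℝ) / 2 : ℝ) = 0 by norm_num, Real.rpow_zero, Complex.ofReal_one]
  have hcoe : (⇑(atkinLehnerInvolution N 2 M f) : ℍ → ℂ) = (∏ q ∈ M.primeFactors, lam q) • ⇑f := by
    rw [atkinLehnerInvolution_apply_eq_slash N 2 M hMN hc f,
      ← slash_eq_slash_atkinLehnerW_of_entries N 2 M hMN hc hm hdet f, hslash, smul_smul, h1, one_mul]
    congr 1
    refine Finset.prod_congr rfl fun q _ ↦ ?_
    rw [h1, inv_one, one_mul]
  apply DFunLike.coe_injective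
  rw [hcoe, CuspForm.IsGLPos.coe_smul]

/-- **For a newform of level `N = pM`, `p ∤ M`: `w_M f = (∏_{q ∣ M} λ(Q_q)(f)) f`** (Knapp 1993,
Thm. 9.27(b),(c); Atkin–Lehner 1970, Thm. 3), with `λ(Q_q)(f) = atkinLehnerEigenvalueAt f q = ±1`.
[cite: Knapp1993, Thm. 9.27] -/
theorem IsNewform0.atkinLehnerInvolution_eq_prod_smul_of_level_eq_mul {p M : ℕ} [NeZero M]
    (hp : p.Prime) (hNM : N = p * M) (hpM : ¬ p ∣ M) {f : CuspForm (Gamma0 N) 2}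
    (hf : IsNewform0 f) :
    atkinLehnerInvolution N 2 M f = (∏ q ∈ M.primeFactors, atkinLehnerEigenvalueAt f q) • f :=
  ModularForms.atkinLehnerInvolution_eq_prod_smul_of_level_eq_mul N hp hNM hpM fun _ hq ↦
    hf.atkinLehnerInvolutionAt_eq_atkinLehnerEigenvalueAt_smul (Nat.prime_of_mem_primeFactors hq)
      (Nat.dvd_of_mem_primeFactors hq)

/-- **`ε(f) = λ(Q_p) · ∏_{q ∣ M} λ(Q_q)`** for a newform of level `N = pM`, `p ∤ M` (Knapp 1993,
Thm. 9.27(c): `ε(f) = ∏_{q ∣ N} λ(Q_q)`, the tree theorem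
`IsNewform0.frickeEigenvalue_eq_prod_atkinLehnerEigenvalueAt_holds`, with `N.primeFactors =
insert p M.primeFactors`). [cite: Knapp1993, Thm. 9.27(c)] -/
theorem IsNewform0.frickeEigenvalue_eq_mul_prod_of_level_eq_mul {p M : ℕ} [NeZero M]
    (hp : p.Prime) (hNM : N = p * M) (hpM : ¬ p ∣ M) {k : ℤ} {f : CuspForm (Gamma0 N) k}
    (hf : IsNewform0 f) :
    frickeEigenvalue f =
      atkinLehnerEigenvalueAt f p * ∏ q ∈ M.primeFactors, atkinLehnerEigenvalueAt f q := by
  have hM0 : M ≠ 0 := NeZero.ne M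
  rw [IsNewform0.frickeEigenvalue_eq_prod_atkinLehnerEigenvalueAt_holds hf]
  have hN : N.primeFactors = insert p M.primeFactors := by
    rw [hNM, Nat.primeFactors_mul hp.ne_zero hM0, hp.primeFactors, Finset.singleton_union]
  have hpn : p ∉ M.primeFactors := fun h ↦ hpM (Nat.dvd_of_mem_primeFactors h)
  rw [hN, Finset.prod_insert hpn]

end Complement

end Literature.NumberTheory.EllipticCurves.ModularForms

end
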